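import Summits.CriticalPhenomena.PercolationContinuityZ3.Theorems.PercNonProliferationFreeBoxSparseTorusParking
import Summits.CriticalPhenomena.PercolationContinuityZ3.Theorems.FreeBoxSparse.Negative.CentredForms
import HarnessLib

/-!
# The torus parking edge of crux `PercHyperscalingGluing.FreeBoxShattering` (stmt-CriticalPhenomena-4644), by name

`NoCriticalTorusGiant → FreeBoxShattering`: no giant on the critical 3-torus (item stmt-CriticalPhenomena-5407 of
route PercTorusSliceFilling; Easo–Hutchcroft arXiv:2112.12778 Rem. 1.4 call it open) implies that the centred free-box
two-point average at `p_c(ℤ³)` vanishes (this crux).  Two landed files composed: the torus parking edge for the twin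
crux `PercNonProliferation.FreeBoxSparse` (stmt-4445, `TorusParking.freeBoxSparse_of_noCriticalTorusGiant`) and the
re-rooting equivalence of the twins (`Negative.freeBoxSparse_iff_hyperscalingGluing_freeBoxShattering`).  Recorded
as a Theorems-level statement with BOTH route decls by name so that the ledger sees the dependency
`stmt-5407 ⇒ stmt-4644` directly (the same composition sits only inside the crux workfile
`Cruxes/FreeBoxShattering/Lines/birth.lean`, `FreeBoxShattering_of_noCriticalTorusGiant`).  It is the nearest
existing upstream item behind which lead c6 parks the crux (LeadC6Note §4).  No definitions; no sorry.
-/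

namespace Summit.CriticalPhenomena.PercolationContinuityZ3.Theorems.FreeBoxShattering

/-- **Torus parking edge, by name**: `PercTorusSliceFilling.NoCriticalTorusGiant` (stmt-CriticalPhenomena-5407)
implies `PercHyperscalingGluing.FreeBoxShattering` (stmt-CriticalPhenomena-4644) — the free box `Λ_m` embeds in the
torus of side `2m+2`, so a dense free piece is a dense torus cluster (landed `TorusParking` edge for the twin
stmt-4445), and the twins are equivalent (landed `CentredForms`). [folklore] -/
theorem freeBoxShattering_of_noCriticalTorusGiant :
    Summit.CriticalPhenomena.PercolationContinuityZ3.Theses.PercTorusSliceFilling.NoCriticalTorusGiant →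
      Summit.CriticalPhenomena.PercolationContinuityZ3.Theses.PercHyperscalingGluing.FreeBoxShattering :=
  fun hT => FreeBoxSparse.Negative.freeBoxSparse_iff_hyperscalingGluing_freeBoxShattering.1
    (FreeBoxSparse.TorusParking.freeBoxSparse_of_noCriticalTorusGiant hT)

end Summit.CriticalPhenomena.PercolationContinuityZ3.Theorems.FreeBoxShattering
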